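import Mathlib
import HarnessLib
import Summits.NavierStokesRegularity.NavierStokesRegularity.Theorems.UnthreadedDoorNetFluxDefs

/-!
# Route `UnthreadedDoor`, crux `PoloidalLiouville` (stmt-NavierStokesRegularity-1222), WALL W1 `stub_scalarLiouville` —
# crux idea «netflux-typei-gap» (ns-idea-14, LINE v5): NF-1cᵛ support — SECOND DIFFERENCES UNDER THE INTEGRAL SIGN

KEY-NS #156/#157/#158 (director-ns g16; author ns-idea-14, «NETFLUX LINE v5» bcd4955f0879, derivation of (L) for
`stub_oneSidedLaw_of_hinges`): "Integrate over `[a,R]` … where `D_k(r) = ∫_r^{r+k} w − ∫_{r−k}^{r} w` (exact identity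
`∫_a^R Δ²_k w = D_k(R) − D_k(a)` for continuous `w`).  As `k ↓ 0`: `D_k(r)/k² → (∂⁺w(r) + ∂⁻w(r))/2`".  This file proves these two
one-variable facts for a function `w` continuous on the relevant interval with one-sided derivatives at `r`:

* `intervalIntegral_secondDiff_eq` — `∫_a^R [w(r+k) − 2w(r) + w(r−k)] dr = D_k(R) − D_k(a)` for `w` continuous on `[a−k, R+k]`;
* `abs_oneSidedMean_sub_le` — for `w` continuous near `r` with right derivative `dp` and left derivative `dm` at `r`: for every
  `ε > 0`, eventually as `k ↓ 0`, `|D_k(r)/k² − (dp + dm)/2| ≤ ε`.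

WHAT THIS IS NOT: no NS-regularity statement is touched (one-variable calculus); SUPPORT lemmas for the line's NF-1cᵛ stub
`stub_oneSidedLaw_of_hinges`, which stays OPEN; `PoloidalLiouville` (1222), W1, the line's rung target and the summit stay OPEN.
`--supports stmt-NavierStokesRegularity-1222 --as helper`.  [folklore]
-/

noncomputable section

-- the summit and its single sub-problem share the name (CONVENTIONS §1)
set_option linter.dupNamespace false

open Set Function Filter Topology MeasureTheory intervalIntegral

namespace Summit.NavierStokesRegularity.NavierStokesRegularity.Theorems.PoloidalLiouville.NetFlux

/-! ### The exact identity `∫_a^R Δ²_k w = D_k(R) − D_k(a)` -/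

/-- **Second differences under the integral sign**: for `w` continuous on `[a − k, R + k]` (`0 ≤ k`, `a ≤ R`),
`∫_a^R [w(r+k) − 2w(r) + w(r−k)] dr = (∫_R^{R+k} w − ∫_{R−k}^R w) − (∫_a^{a+k} w − ∫_{a−k}^a w)`. [folklore] -/
theorem intervalIntegral_secondDiff_eq {w : ℝ → ℝ} {a R k : ℝ} (hk : 0 ≤ k) (haR : a ≤ R)
    (hw : ContinuousOn w (Icc (a - k) (R + k))) :
    ∫ r in a..R, (w (r + k) - 2 * w r + w (r - k)) =
      ((∫ r in R..R + k, w r) - ∫ r in R - k..R, w r) - ((∫ r in a..a + k, w r) - ∫ r in a - k..a, w r) := by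
  -- integrability between any two points of `[a − k, R + k]`
  have hI : ∀ {p q : ℝ}, p ∈ Icc (a - k) (R + k) → q ∈ Icc (a - k) (R + k) → IntervalIntegrable w volume p q := by
    intro p q hp hq
    refine (hw.mono ?_).intervalIntegrable
    exact uIcc_subset_Icc hp hq
  have ha : a ∈ Icc (a - k) (R + k) := ⟨by linarith, by linarith⟩
  have hR : R ∈ Icc (a - k) (R + k) := ⟨by linarith, by linarith⟩
  have hak : a - k ∈ Icc (a - k) (R + k) := ⟨le_rfl, by linarith⟩
  have hak' : a + k ∈ Icc (a - k) (R + k) := ⟨by linarith, by linarith⟩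
  have hRk : R - k ∈ Icc (a - k) (R + k) := ⟨by linarith, by linarith⟩
  have hRk' : R + k ∈ Icc (a - k) (R + k) := ⟨by linarith, le_rfl⟩
  -- every integral as a difference of the primitive from `a − k`
  set F : ℝ → ℝ := fun s => ∫ r in (a - k)..s, w r with hF
  have hFd : ∀ {p q : ℝ}, p ∈ Icc (a - k) (R + k) → q ∈ Icc (a - k) (R + k) → ∫ r in p..q, w r = F q - F p := by
    intro p q hp hq
    rw [hF, integral_interval_sub_left (hI hak hq) (hI hak hp)]
  -- the shifted integrands are integrable on `[a, R]`
  have hcp : ContinuousOn (fun r => w (r + k)) (uIcc a R) := by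
    rw [uIcc_of_le haR]
    refine hw.comp (continuousOn_id.add continuousOn_const) fun r hr => ⟨by linarith [hr.1], by linarith [hr.2]⟩
  have hcm : ContinuousOn (fun r => w (r - k)) (uIcc a R) := by
    rw [uIcc_of_le haR]
    refine hw.comp (continuousOn_id.sub continuousOn_const) fun r hr => ⟨by linarith [hr.1], by linarith [hr.2]⟩
  have hc0 : ContinuousOn (fun r => 2 * w r) (uIcc a R) := by
    rw [uIcc_of_le haR]
    exact continuousOn_const.mul (hw.mono (Icc_subset_Icc (by linarith) (by linarith)))
  rw [integral_add (hcp.intervalIntegrable.sub hc0.intervalIntegrable) hcm.intervalIntegrable,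
    integral_sub hcp.intervalIntegrable hc0.intervalIntegrable, intervalIntegral.integral_const_mul,
    intervalIntegral.integral_comp_add_right (fun r => w r), intervalIntegral.integral_comp_sub_right (fun r => w r),
    hFd hak' hRk', hFd ha hR, hFd hak hRk, hFd hR hRk', hFd hRk hR, hFd ha hak', hFd hak ha]
  ring

/-! ### The one-sided mean: `D_k(r)/k² → (∂⁺w + ∂⁻w)/2` -/

/-- `∫_r^{r+k} (c + d (s − r)) ds = c k + d k²/2`. [folklore] -/
theorem intervalIntegral_affine_right (c d r k : ℝ) :
    ∫ s in r..r + k, (c + d * (s - r)) = c * k + d * k ^ 2 / 2 := by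
  have h1 : ∫ s in r..r + k, (c + d * (s - r)) = ∫ s in (0:ℝ)..k, (c + d * s) := by
    have h := intervalIntegral.integral_comp_sub_right (fun y => c + d * y) r (a := r) (b := r + k)
    simp only [sub_self, add_sub_cancel_left] at h
    exact h
  have hi : IntervalIntegrable (fun s : ℝ => d * s) volume 0 k :=
    (by fun_prop : Continuous fun s : ℝ => d * s).intervalIntegrable _ _
  rw [h1, integral_add intervalIntegrable_const hi, intervalIntegral.integral_const, intervalIntegral.integral_const_mul,
    integral_id]
  simp only [sub_zero, smul_eq_mul]
  ring

/-- `∫_{r−k}^{r} (c + d (s − r)) ds = c k − d k²/2`. [folklore] -/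
theorem intervalIntegral_affine_left (c d r k : ℝ) :
    ∫ s in r - k..r, (c + d * (s - r)) = c * k - d * k ^ 2 / 2 := by
  have h1 : ∫ s in r - k..r, (c + d * (s - r)) = ∫ s in (-k : ℝ)..0, (c + d * s) := by
    have h := intervalIntegral.integral_comp_sub_right (fun y => c + d * y) r (a := r - k) (b := r)
    simp only [sub_self, sub_sub_cancel_left] at h
    exact h
  have hi : IntervalIntegrable (fun s : ℝ => d * s) volume (-k) 0 :=
    (by fun_prop : Continuous fun s : ℝ => d * s).intervalIntegrable _ _
  rw [h1, integral_add intervalIntegrable_const hi, intervalIntegral.integral_const, intervalIntegral.integral_const_mul,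
    integral_id]
  simp only [sub_neg_eq_add, zero_add, smul_eq_mul]
  ring

/-- **The one-sided mean of the second difference**: if `w` is continuous on a neighbourhood `[r − k₀, r + k₀]` of `r` and has right
derivative `dp` and left derivative `dm` at `r`, then for every `ε > 0`, eventually as `k ↓ 0`,
`|(∫_r^{r+k} w − ∫_{r−k}^r w)/k² − (dp + dm)/2| ≤ ε`. [folklore] -/
theorem abs_oneSidedMean_sub_le {w : ℝ → ℝ} {r dp dm k₀ : ℝ} (hk₀ : 0 < k₀) (hw : ContinuousOn w (Icc (r - k₀) (r + k₀)))
    (hp : HasDerivWithinAt w dp (Ioi r) r) (hm : HasDerivWithinAt w dm (Iio r) r) :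
    ∀ ε > 0, ∀ᶠ k in 𝓝[>] (0 : ℝ),
      |((∫ s in r..r + k, w s) - ∫ s in r - k..r, w s) / k ^ 2 - (dp + dm) / 2| ≤ ε := by
  intro ε hε
  have hε2 : 0 < ε / 2 := half_pos hε
  -- the one-sided little-o estimates
  have hp' := (hasDerivWithinAt_iff_isLittleO.1 hp).def hε2
  have hm' := (hasDerivWithinAt_iff_isLittleO.1 hm).def hε2
  rw [eventually_nhdsWithin_iff, Metric.eventually_nhds_iff] at hp' hm'
  obtain ⟨δ₁, hδ₁, hp''⟩ := hp'
  obtain ⟨δ₂, hδ₂, hm''⟩ := hm'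
  rw [eventually_nhdsWithin_iff, Metric.eventually_nhds_iff]
  refine ⟨min k₀ (min δ₁ δ₂), lt_min hk₀ (lt_min hδ₁ hδ₂), fun k hk hk0 => ?_⟩
  rw [Real.dist_eq, sub_zero] at hk
  have hk0 : 0 < k := hk0
  have hkabs : |k| = k := abs_of_pos hk0
  rw [hkabs] at hk
  have hkk₀ : k < k₀ := lt_of_lt_of_le hk (min_le_left _ _)
  have hkδ₁ : k < δ₁ := lt_of_lt_of_le hk ((min_le_right _ _).trans (min_le_left _ _))
  have hkδ₂ : k < δ₂ := lt_of_lt_of_le hk ((min_le_right _ _).trans (min_le_right _ _))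
  -- continuity ⇒ integrability on the two small intervals
  have hcr : ContinuousOn w (uIcc r (r + k)) := by
    rw [uIcc_of_le (by linarith)]; exact hw.mono (Icc_subset_Icc (by linarith) (by linarith))
  have hcl : ContinuousOn w (uIcc (r - k) r) := by
    rw [uIcc_of_le (by linarith)]; exact hw.mono (Icc_subset_Icc (by linarith) (by linarith))
  -- right interval: `|∫_r^{r+k} w − (w r · k + dp k²/2)| ≤ (ε/2) k · k`
  have hR : |(∫ s in r..r + k, w s) - (w r * k + dp * k ^ 2 / 2)| ≤ ε / 2 * k * k := by
    have hi : IntervalIntegrable (fun s : ℝ => w r + dp * (s - r)) volume r (r + k) :=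
      (by fun_prop : Continuous fun s : ℝ => w r + dp * (s - r)).intervalIntegrable _ _
    rw [← intervalIntegral_affine_right (w r) dp r k, ← integral_sub hcr.intervalIntegrable hi]
    have hb : ∀ s ∈ Set.uIoc r (r + k), ‖w s - (w r + dp * (s - r))‖ ≤ ε / 2 * k := by
      intro s hs
      rw [uIoc_of_le (by linarith)] at hs
      have hs' : s ∈ Ioi r := hs.1
      have hsd : dist s r < δ₁ := by rw [Real.dist_eq, abs_of_pos (by linarith [hs.1])]; linarith [hs.2]
      have h := hp'' hsd hs'
      rw [smul_eq_mul, Real.norm_eq_abs, Real.norm_eq_abs, abs_of_pos (by linarith [hs.1] : (0:ℝ) < s - r)] at h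
      rw [Real.norm_eq_abs, show w s - (w r + dp * (s - r)) = w s - w r - (s - r) * dp by ring]
      calc |w s - w r - (s - r) * dp| ≤ ε / 2 * (s - r) := h
        _ ≤ ε / 2 * k := mul_le_mul_of_nonneg_left (by linarith [hs.2]) hε2.le
    have h := intervalIntegral.norm_integral_le_of_norm_le_const hb
    rw [Real.norm_eq_abs, show r + k - r = k by ring, hkabs] at h
    exact h
  -- left interval: `|∫_{r−k}^r w − (w r · k − dm k²/2)| ≤ (ε/2) k · k`
  have hL : |(∫ s in r - k..r, w s) - (w r * k - dm * k ^ 2 / 2)| ≤ ε / 2 * k * k := by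
    have hi : IntervalIntegrable (fun s : ℝ => w r + dm * (s - r)) volume (r - k) r :=
      (by fun_prop : Continuous fun s : ℝ => w r + dm * (s - r)).intervalIntegrable _ _
    rw [← intervalIntegral_affine_left (w r) dm r k, ← integral_sub hcl.intervalIntegrable hi]
    have hb : ∀ s ∈ Set.uIoc (r - k) r, ‖w s - (w r + dm * (s - r))‖ ≤ ε / 2 * k := by
      intro s hs
      rw [uIoc_of_le (by linarith)] at hs
      rcases eq_or_lt_of_le hs.2 with hsr | hsr
      · rw [hsr, sub_self, mul_zero, add_zero, sub_self, norm_zero]; positivity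
      · have hs' : s ∈ Iio r := hsr
        have hsd : dist s r < δ₂ := by rw [Real.dist_eq, abs_of_neg (by linarith)]; linarith [hs.1]
        have h := hm'' hsd hs'
        rw [smul_eq_mul, Real.norm_eq_abs, Real.norm_eq_abs, abs_of_neg (by linarith : s - r < 0)] at h
        rw [Real.norm_eq_abs, show w s - (w r + dm * (s - r)) = w s - w r - (s - r) * dm by ring]
        calc |w s - w r - (s - r) * dm| ≤ ε / 2 * -(s - r) := h
          _ ≤ ε / 2 * k := mul_le_mul_of_nonneg_left (by linarith [hs.1]) hε2.le
    have h := intervalIntegral.norm_integral_le_of_norm_le_const hb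
    rw [Real.norm_eq_abs, show r - (r - k) = k by ring, hkabs] at h
    exact h
  -- combine
  have hk2 : (0 : ℝ) < k ^ 2 := by positivity
  have hRL := abs_sub _ _ |>.trans (add_le_add hR hL)
  -- `hRL : |(∫…) − (…) − ((∫…) − (…))| ≤ ε/2·k·k + ε/2·k·k`
  have e : ((∫ s in r..r + k, w s) - ∫ s in r - k..r, w s) / k ^ 2 - (dp + dm) / 2
      = (((∫ s in r..r + k, w s) - (w r * k + dp * k ^ 2 / 2)) - ((∫ s in r - k..r, w s) - (w r * k - dm * k ^ 2 / 2))) / k ^ 2 := by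
    field_simp
    ring
  rw [e, abs_div, abs_of_pos hk2, div_le_iff₀ hk2]
  calc |((∫ s in r..r + k, w s) - (w r * k + dp * k ^ 2 / 2)) - ((∫ s in r - k..r, w s) - (w r * k - dm * k ^ 2 / 2))|
      ≤ ε / 2 * k * k + ε / 2 * k * k := hRL
    _ = ε * k ^ 2 := by ring

end Summit.NavierStokesRegularity.NavierStokesRegularity.Theorems.PoloidalLiouville.NetFlux

end
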